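import Literature.Probability.RandomPlanarGeometry.SAWPulledBridgeZdMemoryThreeTransfer
import Literature.Probability.RandomPlanarGeometry.SAWPulledHalfSpaceFreeEnergy
import Literature.Analysis.ValidatedNumerics.BivariateBernsteinCertificate
import HarnessLib

/-!
# The connective constant of `ℤ^D` in EVERY dimension, from above, by the memory-three transfer certificate:
# `μ(ℤ^D) ≤ 2D − 1 − 1/(2D) + 1/(2D²)` for all `D ≥ 2`, and `μ(ℤ^D) ≤ 2D − 1 − 1/(2D) + 1/(2D)² + 1/(2D)³` for all `D ≥ 3`
# — an INDEPENDENT, kernel-certified route to the Fisher–Sykes (no reversal, no unit square) ceiling of `SAWLoopErasureKesten.lean`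

ERRATUM TO THE FIRST EDITION'S PROSE (the first edition's declarations are unchanged; one corollary is added at the end): the tree file `SAWLoopErasureKesten.lean` already proves
`connectiveConstant_lt_kesten_upper : μ(ℤ^d) < 2d − 1 − 1/(2d) + 1/(2d²)` for EVERY `d ≥ 2` (not only `d ≥ 5`, and not from the loop
erasure: from the Fisher–Sykes cubic `θ³ − 2(d−1)θ² − 2(d−1)θ − 1`, `connectiveConstant_cube_le_fisherSykes`, with the closed form
`connectiveConstant_lt_fisherSykes_closed_form : μ(ℤ^d) < 2d − 1 − 1/(2d+2)`).  That cubic is the characteristic polynomial of the very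
Markov chain used here (self-avoidance within three steps), so `connectiveConstant_le_memoryThree` / `connectiveConstant_le_memoryThree_dim`
below RESTATE `connectiveConstant_lt_kesten_upper` in `≤` form by an independent proof (thirteen-state transfer operator + integer potential +
kernel certificates instead of the cubic), and `connectiveConstant_le_memoryThree'` (`+ 1/(2D)² + 1/(2D)³`, `D ≥ 3`) is a closed form SHARPER than
`connectiveConstant_lt_fisherSykes_closed_form` for every `D ≥ 3` (e.g. `4.8657 < 4.875` at `D = 3`, `6.8926 < 6.9` at `D = 4`; asymptotically by
`1/(4D²)`), which could equally be read off the cubic by a sign computation.  The mathematical ceiling is the same memory-three root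
`2D − 1 − 1/(2D) + 1/(2D)² + 4/(2D)⁴ + …` in both files; what this file adds is the certificate METHOD at `y = 1` (the same tables-and-certificates
format that gives the pulled envelopes `SAWPulledBridgeFreeEnergyZdFifthOrderEnvelope.lean` at `y ≥ 1`) and the sharper closed form.

Topic `Literature/Probability/RandomPlanarGeometry` (an every-dimension companion of `SAWConnectiveConstantLowerAllDimensions.lean` and of
`SAWLoopErasureKesten.lean` (see the erratum above); uses the thirteen-state memory-three transfer bound `MemThree.exp_pulledBridgeFreeEnergy_le`
of `SAWPulledBridgeZdMemoryThreeTransfer.lean` at force `y = 1`, where `e^{λ_B(1)} = μ` (`pulledBridgeFreeEnergy_one` of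
`SAWPulledHalfSpaceFreeEnergy.lean`), and the kernel certificate checker `BivBernstein.bernCert` of
`Literature/Analysis/ValidatedNumerics/BivariateBernsteinCertificate.lean`).

At `y = 1` the memory-three (no reversal, no unit square) transfer operator of `ℤ^{d+1}` = `ℤ^D` depends on `D` alone; with `ν := 1/(2D)` its
Perron root is `2D − 1 − 1/(2D) + 1/(2D)² + 0·(2D)^{-3} + 4/(2D)⁴ + …` (exact perturbation series in `ν`; the INTEGER Perron-vector
coefficients are the tables `MuUpper.PHI_*` below, truncated at `ν⁵`).  Memory three does NOT see the `−3/(2D)²` of the true `1/D` expansion of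
`μ` (that needs longer memory), so this is weaker than Hara–Slade–Sokal for large `D`, and as a ceiling it coincides with the Fisher–Sykes cubic of
`SAWLoopErasureKesten.lean` (erratum above); its point is ONE elementary, kernel-certified TRANSFER argument for EVERY dimension at once,
including `D = 2, 3, 4`: the thirteen row inequalities of `MemThree.Supersolution d 1 ρ φ` with
`ρ = 2D − 1 − 1/(2D) + 2/(2D)²` are univariate integer polynomials in `ν ∈ (0, 1/4]` with non-negative Bernstein coefficients (certificates
`MuUpper.cert1_*`), and with `ρ = 2D − 1 − 1/(2D) + 1/(2D)² + 1/(2D)³` on `ν ∈ (0, 1/6]` (`MuUpper.cert2_*`).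

RESULTS: ★ **`connectiveConstant_le_memoryThree (d) (hd : 1 ≤ d) : μ(ℤ^{d+1}) ≤ 2d + 1 − 1/(2d+2) + 2/(2d+2)²`** (every `D = d+1 ≥ 2`;
numerically `2.875, 4.889, 6.906, 8.920, …` against `μ = 2.638, 4.684, 6.774, 8.838, …`; the `≤` form of the tree's
`connectiveConstant_lt_kesten_upper`, independent proof), ★★ **`connectiveConstant_le_memoryThree' (hd : 2 ≤ d) :
μ(ℤ^{d+1}) ≤ 2d + 1 − 1/(2d+2) + 1/(2d+2)² + 1/(2d+2)³`** (`D ≥ 3`: `4.8657, 6.8926, 8.9110, …`; the memory-three root itself is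
`4.8645, 6.8917, 8.9104, …`; sharper than the tree's closed form `2d − 1 − 1/(2d+2)` = `4.875, 6.9, 8.9167, …`).

Printed status: the finite-memory (Fisher–Sykes) upper bounds are classical [Fisher–Sykes 1959; Madras–Slade (1.2.14)]; Kesten 1964 /
Hara–Slade–Sokal 1993 give the `1/D` expansion; in the tree the every-`d` closed forms are `connectiveConstant_lt_fisherSykes_closed_form` /
`connectiveConstant_lt_kesten_upper` (`SAWLoopErasureKesten.lean`).  Provenance: lane «pcv-sawmu», a-p3 g27 (2026-08-28; second edition = prose
erratum, existing declarations byte-identical, plus the dimension-variable corollary `connectiveConstant_le_memoryThree_dim'`); tables / certificates generated in exact arithmetic (`HOME/pub-sawmu-a-p3/g27/numerics/mu2.py`, `mu3.py`,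
`mkcarG.py`).  PURE STD; 39 `decide +kernel` checks of tiny univariate certificates.
-/

noncomputable section

open Finset Filter Topology
open scoped BigOperators
open Literature.Probability.LatticeModels
open Literature.Probability.RandomPlanarGeometry.SAW
open Literature.Analysis.ValidatedNumerics.BivBernstein

namespace Literature.Probability.RandomPlanarGeometry.SAW.Zd

namespace MuUpper

open MemThree

/-! ### Tables (polynomials in `ν = 1/(2d+2)`; as bivariate lists constant in the first variable, outer index = power of `ν`) -/

/-- `ν·ρ₁ = 1 − ν − ν² + 2ν³` (`ρ₁ = 2D − 1 − 1/(2D) + 2/(2D)²`). [cite: MadrasSlade1993, §1.2, eq. (1.2.12)–(1.2.14)] -/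
def RHO1 : List (List ℤ) := [[1], [-1], [-1], [2]]
/-- `ν·ρ₂ = 1 − ν − ν² + ν³ + ν⁴` (`ρ₂ = 2D − 1 − 1/(2D) + 1/(2D)² + 1/(2D)³`). [cite: MadrasSlade1993, §1.2, eq. (1.2.12)–(1.2.14)] -/
def RHO2 : List (List ℤ) := [[1], [-1], [-1], [1], [1]]
/-- `ν`. [cite: MadrasSlade1993, §1.2, eq. (1.2.12)–(1.2.14)] -/
def NU : List (List ℤ) := [[], [1]]
/-- `(2d−k)·ν = 1 − (k+2)ν`. [cite: MadrasSlade1993, §1.2, eq. (1.2.12)–(1.2.14)] -/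
def LAT (k : ℕ) : List (List ℤ) := [[1], [-((k : ℤ) + 2)]]
/-- Perron-vector coefficients of the class `UU` through `ν⁵` (integers). [cite: MadrasSlade1993, §1.2, eq. (1.2.12)–(1.2.14)] -/
def PHI_UU : List (List ℤ) := [[1], [], [1], [1], [3], [2]]
/-- Perron-vector coefficients of the class `LU0` through `ν⁵` (integers). [cite: MadrasSlade1993, §1.2, eq. (1.2.12)–(1.2.14)] -/
def PHI_LU0 : List (List ℤ) := [[1]]
/-- Perron-vector coefficients of the class `LU1` through `ν⁵` (integers). [cite: MadrasSlade1993, §1.2, eq. (1.2.12)–(1.2.14)] -/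
def PHI_LU1 : List (List ℤ) := [[1], [-1], [], [-1], [1], [-1]]
/-- Perron-vector coefficients of the class `UL0` through `ν⁵` (integers). [cite: MadrasSlade1993, §1.2, eq. (1.2.12)–(1.2.14)] -/
def PHI_UL0 : List (List ℤ) := [[1]]
/-- Perron-vector coefficients of the class `UL1` through `ν⁵` (integers). [cite: MadrasSlade1993, §1.2, eq. (1.2.12)–(1.2.14)] -/
def PHI_UL1 : List (List ℤ) := [[1], [-1], [], [-1], [1], [-1]]
/-- Perron-vector coefficients of the class `DL0` through `ν⁵` (integers). [cite: MadrasSlade1993, §1.2, eq. (1.2.12)–(1.2.14)] -/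
def PHI_DL0 : List (List ℤ) := [[1]]
/-- Perron-vector coefficients of the class `DL1` through `ν⁵` (integers). [cite: MadrasSlade1993, §1.2, eq. (1.2.12)–(1.2.14)] -/
def PHI_DL1 : List (List ℤ) := [[1], [-1], [], [-1], [1], [-1]]
/-- Perron-vector coefficients of the class `LLs` through `ν⁵` (integers). [cite: MadrasSlade1993, §1.2, eq. (1.2.12)–(1.2.14)] -/
def PHI_LLs : List (List ℤ) := [[1], [], [1], [1], [3], [2]]
/-- Perron-vector coefficients of the class `LLp0` through `ν⁵` (integers). [cite: MadrasSlade1993, §1.2, eq. (1.2.12)–(1.2.14)] -/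
def PHI_LLp0 : List (List ℤ) := [[1]]
/-- Perron-vector coefficients of the class `LLp1` through `ν⁵` (integers). [cite: MadrasSlade1993, §1.2, eq. (1.2.12)–(1.2.14)] -/
def PHI_LLp1 : List (List ℤ) := [[1], [-1], [], [-1], [1], [-1]]
/-- Perron-vector coefficients of the class `LD0` through `ν⁵` (integers). [cite: MadrasSlade1993, §1.2, eq. (1.2.12)–(1.2.14)] -/
def PHI_LD0 : List (List ℤ) := [[1]]
/-- Perron-vector coefficients of the class `LD1` through `ν⁵` (integers). [cite: MadrasSlade1993, §1.2, eq. (1.2.12)–(1.2.14)] -/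
def PHI_LD1 : List (List ℤ) := [[1], [-1], [], [-1], [1], [-1]]
/-- Perron-vector coefficients of the class `DD` through `ν⁵` (integers). [cite: MadrasSlade1993, §1.2, eq. (1.2.12)–(1.2.14)] -/
def PHI_DD : List (List ℤ) := [[1], [], [1], [1], [3], [2]]

/-- The table of the class `s`. [cite: MadrasSlade1993, §1.2, eq. (1.2.12)–(1.2.14)] -/
def PHI : St → List (List ℤ)
  | .UU => PHI_UU | .LU0 => PHI_LU0 | .LU1 => PHI_LU1 | .UL0 => PHI_UL0 | .UL1 => PHI_UL1 | .DL0 => PHI_DL0 | .DL1 => PHI_DL1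
  | .LLs => PHI_LLs | .LLp0 => PHI_LLp0 | .LLp1 => PHI_LLp1 | .LD0 => PHI_LD0 | .LD1 => PHI_LD1 | .DD => PHI_DD

/-- The potential at `ν`: `φ(s) = PHI_s(ν)`. [cite: MadrasSlade1993, §1.2, eq. (1.2.12)–(1.2.14)] -/
def phi (ν : ℝ) (s : St) : ℝ := evalB (PHI s) 0 ν

/-- The transfer part of each row (times `ν`): `Σ_{s'} (νM)_{ss'} PHI_{s'}`. [cite: MadrasSlade1993, §1.2, eq. (1.2.12)–(1.2.14)] -/
def TRF : St → List (List ℤ)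
  | .UU => addB (mulB NU PHI_UU) (mulB (LAT 0) PHI_UL0)
  | .LU0 => addB (addB (mulB NU PHI_UU) (mulB (LAT 1) PHI_UL0)) (mulB NU PHI_UL1)
  | .LU1 => addB (mulB NU PHI_UU) (mulB (LAT 1) PHI_UL0)
  | .UL0 => addB (addB (addB (mulB NU PHI_LU0) (mulB NU PHI_LD1)) (mulB NU PHI_LLs)) (mulB (LAT 2) PHI_LLp0)
  | .UL1 => addB (addB (mulB NU PHI_LU0) (mulB NU PHI_LLs)) (mulB (LAT 2) PHI_LLp0)
  | .DL0 => addB (addB (addB (mulB NU PHI_LU1) (mulB NU PHI_LD0)) (mulB NU PHI_LLs)) (mulB (LAT 2) PHI_LLp0)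
  | .DL1 => addB (addB (mulB NU PHI_LD0) (mulB NU PHI_LLs)) (mulB (LAT 2) PHI_LLp0)
  | .LLs => addB (addB (addB (mulB NU PHI_LU0) (mulB NU PHI_LD0)) (mulB NU PHI_LLs)) (mulB (LAT 2) PHI_LLp0)
  | .LLp0 => addB (addB (addB (addB (mulB NU PHI_LU0) (mulB NU PHI_LD0)) (mulB NU PHI_LLs)) (mulB (LAT 3) PHI_LLp0)) (mulB NU PHI_LLp1)
  | .LLp1 => addB (addB (addB (mulB NU PHI_LU0) (mulB NU PHI_LD0)) (mulB NU PHI_LLs)) (mulB (LAT 3) PHI_LLp0)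
  | .LD0 => addB (addB (mulB NU PHI_DD) (mulB (LAT 1) PHI_DL0)) (mulB NU PHI_DL1)
  | .LD1 => addB (mulB NU PHI_DD) (mulB (LAT 1) PHI_DL0)
  | .DD => addB (mulB NU PHI_DD) (mulB (LAT 0) PHI_DL0)

/-- Row polynomial at `ρ₁`: `(νρ₁)·PHI_s − TRF_s`. [cite: MadrasSlade1993, §1.2, eq. (1.2.12)–(1.2.14)] -/
def ROW1 (s : St) : List (List ℤ) := subB (mulB RHO1 (PHI s)) (TRF s)
/-- Row polynomial at `ρ₂`. [cite: MadrasSlade1993, §1.2, eq. (1.2.12)–(1.2.14)] -/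
def ROW2 (s : St) : List (List ℤ) := subB (mulB RHO2 (PHI s)) (TRF s)
/-- Positivity polynomial `2·PHI_s − 1`. [cite: MadrasSlade1993, §1.2, eq. (1.2.12)–(1.2.14)] -/
def POSP (s : St) : List (List ℤ) := subB (smulB 2 (PHI s)) [[1]]

/-! ### Certificates -/
/-- Row `UU` at `ρ1` on `ν ∈ [0, 1/4]`. [cite: GarloffSmith2001, §2.1 Lemma 1 (i) eq. (3)] -/
theorem cert1_UU : bernCert 0 8 4 (ROW1 .UU) [[0, 0, 0, 1024, 5120, 10048, 9584, 4400, 772]] = true := by decide +kernel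
/-- Row `LU0` at `ρ1` on `ν ∈ [0, 1/4]`. [cite: GarloffSmith2001, §2.1 Lemma 1 (i) eq. (3)] -/
theorem cert1_LU0 : bernCert 0 6 4 (ROW1 .LU0) [[0, 0, 0, 64, 192, 176, 47]] = true := by decide +kernel
/-- Row `LU1` at `ρ1` on `ν ∈ [0, 1/4]`. [cite: GarloffSmith2001, §2.1 Lemma 1 (i) eq. (3)] -/
theorem cert1_LU1 : bernCert 0 8 4 (ROW1 .LU1) [[0, 0, 0, 1024, 4864, 8960, 7872, 3212, 458]] = true := by decide +kernel
/-- Row `UL0` at `ρ1` on `ν ∈ [0, 1/4]`. [cite: GarloffSmith2001, §2.1 Lemma 1 (i) eq. (3)] -/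
theorem cert1_UL0 : bernCert 0 6 4 (ROW1 .UL0) [[0, 0, 0, 64, 192, 176, 47]] = true := by decide +kernel
/-- Row `UL1` at `ρ1` on `ν ∈ [0, 1/4]`. [cite: GarloffSmith2001, §2.1 Lemma 1 (i) eq. (3)] -/
theorem cert1_UL1 : bernCert 0 8 4 (ROW1 .UL1) [[0, 0, 0, 1024, 4864, 8960, 7872, 3212, 458]] = true := by decide +kernel
/-- Row `DL0` at `ρ1` on `ν ∈ [0, 1/4]`. [cite: GarloffSmith2001, §2.1 Lemma 1 (i) eq. (3)] -/
theorem cert1_DL0 : bernCert 0 6 4 (ROW1 .DL0) [[0, 0, 0, 64, 192, 176, 47]] = true := by decide +kernel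
/-- Row `DL1` at `ρ1` on `ν ∈ [0, 1/4]`. [cite: GarloffSmith2001, §2.1 Lemma 1 (i) eq. (3)] -/
theorem cert1_DL1 : bernCert 0 8 4 (ROW1 .DL1) [[0, 0, 0, 1024, 4864, 8960, 7872, 3212, 458]] = true := by decide +kernel
/-- Row `LLs` at `ρ1` on `ν ∈ [0, 1/4]`. [cite: GarloffSmith2001, §2.1 Lemma 1 (i) eq. (3)] -/
theorem cert1_LLs : bernCert 0 8 4 (ROW1 .LLs) [[0, 0, 0, 1024, 5120, 10048, 9584, 4400, 772]] = true := by decide +kernel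
/-- Row `LLp0` at `ρ1` on `ν ∈ [0, 1/4]`. [cite: GarloffSmith2001, §2.1 Lemma 1 (i) eq. (3)] -/
theorem cert1_LLp0 : bernCert 0 6 4 (ROW1 .LLp0) [[0, 0, 0, 64, 192, 176, 47]] = true := by decide +kernel
/-- Row `LLp1` at `ρ1` on `ν ∈ [0, 1/4]`. [cite: GarloffSmith2001, §2.1 Lemma 1 (i) eq. (3)] -/
theorem cert1_LLp1 : bernCert 0 8 4 (ROW1 .LLp1) [[0, 0, 0, 1024, 4864, 8960, 7872, 3212, 458]] = true := by decide +kernel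
/-- Row `LD0` at `ρ1` on `ν ∈ [0, 1/4]`. [cite: GarloffSmith2001, §2.1 Lemma 1 (i) eq. (3)] -/
theorem cert1_LD0 : bernCert 0 6 4 (ROW1 .LD0) [[0, 0, 0, 64, 192, 176, 47]] = true := by decide +kernel
/-- Row `LD1` at `ρ1` on `ν ∈ [0, 1/4]`. [cite: GarloffSmith2001, §2.1 Lemma 1 (i) eq. (3)] -/
theorem cert1_LD1 : bernCert 0 8 4 (ROW1 .LD1) [[0, 0, 0, 1024, 4864, 8960, 7872, 3212, 458]] = true := by decide +kernel
/-- Row `DD` at `ρ1` on `ν ∈ [0, 1/4]`. [cite: GarloffSmith2001, §2.1 Lemma 1 (i) eq. (3)] -/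
theorem cert1_DD : bernCert 0 8 4 (ROW1 .DD) [[0, 0, 0, 1024, 5120, 10048, 9584, 4400, 772]] = true := by decide +kernel
/-- Row `UU` at `ρ2` on `ν ∈ [0, 1/6]`. [cite: GarloffSmith2001, §2.1 Lemma 1 (i) eq. (3)] -/
theorem cert2_UU : bernCert 0 9 6 (ROW2 .UU) [[0, 0, 0, 0, 7776, 33696, 55944, 43488, 15078, 1616]] = true := by decide +kernel
/-- Row `LU0` at `ρ2` on `ν ∈ [0, 1/6]`. [cite: GarloffSmith2001, §2.1 Lemma 1 (i) eq. (3)] -/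
theorem cert2_LU0 : bernCert 0 6 6 (ROW2 .LU0) [[0, 0, 0, 0, 36, 48, 11]] = true := by decide +kernel
/-- Row `LU1` at `ρ2` on `ν ∈ [0, 1/6]`. [cite: GarloffSmith2001, §2.1 Lemma 1 (i) eq. (3)] -/
theorem cert2_LU1 : bernCert 0 9 6 (ROW2 .LU1) [[0, 0, 0, 0, 7776, 32400, 51192, 36972, 11088, 683]] = true := by decide +kernel
/-- Row `UL0` at `ρ2` on `ν ∈ [0, 1/6]`. [cite: GarloffSmith2001, §2.1 Lemma 1 (i) eq. (3)] -/
theorem cert2_UL0 : bernCert 0 6 6 (ROW2 .UL0) [[0, 0, 0, 0, 36, 48, 11]] = true := by decide +kernel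
/-- Row `UL1` at `ρ2` on `ν ∈ [0, 1/6]`. [cite: GarloffSmith2001, §2.1 Lemma 1 (i) eq. (3)] -/
theorem cert2_UL1 : bernCert 0 9 6 (ROW2 .UL1) [[0, 0, 0, 0, 7776, 32400, 51192, 36972, 11088, 683]] = true := by decide +kernel
/-- Row `DL0` at `ρ2` on `ν ∈ [0, 1/6]`. [cite: GarloffSmith2001, §2.1 Lemma 1 (i) eq. (3)] -/
theorem cert2_DL0 : bernCert 0 6 6 (ROW2 .DL0) [[0, 0, 0, 0, 36, 48, 11]] = true := by decide +kernel
/-- Row `DL1` at `ρ2` on `ν ∈ [0, 1/6]`. [cite: GarloffSmith2001, §2.1 Lemma 1 (i) eq. (3)] -/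
theorem cert2_DL1 : bernCert 0 9 6 (ROW2 .DL1) [[0, 0, 0, 0, 7776, 32400, 51192, 36972, 11088, 683]] = true := by decide +kernel
/-- Row `LLs` at `ρ2` on `ν ∈ [0, 1/6]`. [cite: GarloffSmith2001, §2.1 Lemma 1 (i) eq. (3)] -/
theorem cert2_LLs : bernCert 0 9 6 (ROW2 .LLs) [[0, 0, 0, 0, 7776, 33696, 55944, 43488, 15078, 1616]] = true := by decide +kernel
/-- Row `LLp0` at `ρ2` on `ν ∈ [0, 1/6]`. [cite: GarloffSmith2001, §2.1 Lemma 1 (i) eq. (3)] -/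
theorem cert2_LLp0 : bernCert 0 6 6 (ROW2 .LLp0) [[0, 0, 0, 0, 36, 48, 11]] = true := by decide +kernel
/-- Row `LLp1` at `ρ2` on `ν ∈ [0, 1/6]`. [cite: GarloffSmith2001, §2.1 Lemma 1 (i) eq. (3)] -/
theorem cert2_LLp1 : bernCert 0 9 6 (ROW2 .LLp1) [[0, 0, 0, 0, 7776, 32400, 51192, 36972, 11088, 683]] = true := by decide +kernel
/-- Row `LD0` at `ρ2` on `ν ∈ [0, 1/6]`. [cite: GarloffSmith2001, §2.1 Lemma 1 (i) eq. (3)] -/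
theorem cert2_LD0 : bernCert 0 6 6 (ROW2 .LD0) [[0, 0, 0, 0, 36, 48, 11]] = true := by decide +kernel
/-- Row `LD1` at `ρ2` on `ν ∈ [0, 1/6]`. [cite: GarloffSmith2001, §2.1 Lemma 1 (i) eq. (3)] -/
theorem cert2_LD1 : bernCert 0 9 6 (ROW2 .LD1) [[0, 0, 0, 0, 7776, 32400, 51192, 36972, 11088, 683]] = true := by decide +kernel
/-- Row `DD` at `ρ2` on `ν ∈ [0, 1/6]`. [cite: GarloffSmith2001, §2.1 Lemma 1 (i) eq. (3)] -/
theorem cert2_DD : bernCert 0 9 6 (ROW2 .DD) [[0, 0, 0, 0, 7776, 33696, 55944, 43488, 15078, 1616]] = true := by decide +kernel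
/-- `2·PHI_UU − 1 ≥ 0` on `ν ∈ [0, 1/4]`. [cite: GarloffSmith2001, §2.1 Lemma 1 (i) eq. (3)] -/
theorem certP_UU : bernCert 0 5 4 (POSP .UU) [[1024, 5120, 10368, 10656, 5592, 1212]] = true := by decide +kernel
/-- `2·PHI_LU0 − 1 ≥ 0` on `ν ∈ [0, 1/4]`. [cite: GarloffSmith2001, §2.1 Lemma 1 (i) eq. (3)] -/
theorem certP_LU0 : bernCert 0 5 4 (POSP .LU0) [[1024, 5120, 10240, 10240, 5120, 1024]] = true := by decide +kernel
/-- `2·PHI_LU1 − 1 ≥ 0` on `ν ∈ [0, 1/4]`. [cite: GarloffSmith2001, §2.1 Lemma 1 (i) eq. (3)] -/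
theorem certP_LU1 : bernCert 0 5 4 (POSP .LU1) [[1024, 4608, 8192, 7136, 3016, 486]] = true := by decide +kernel
/-- `2·PHI_UL0 − 1 ≥ 0` on `ν ∈ [0, 1/4]`. [cite: GarloffSmith2001, §2.1 Lemma 1 (i) eq. (3)] -/
theorem certP_UL0 : bernCert 0 5 4 (POSP .UL0) [[1024, 5120, 10240, 10240, 5120, 1024]] = true := by decide +kernel
/-- `2·PHI_UL1 − 1 ≥ 0` on `ν ∈ [0, 1/4]`. [cite: GarloffSmith2001, §2.1 Lemma 1 (i) eq. (3)] -/
theorem certP_UL1 : bernCert 0 5 4 (POSP .UL1) [[1024, 4608, 8192, 7136, 3016, 486]] = true := by decide +kernel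
/-- `2·PHI_DL0 − 1 ≥ 0` on `ν ∈ [0, 1/4]`. [cite: GarloffSmith2001, §2.1 Lemma 1 (i) eq. (3)] -/
theorem certP_DL0 : bernCert 0 5 4 (POSP .DL0) [[1024, 5120, 10240, 10240, 5120, 1024]] = true := by decide +kernel
/-- `2·PHI_DL1 − 1 ≥ 0` on `ν ∈ [0, 1/4]`. [cite: GarloffSmith2001, §2.1 Lemma 1 (i) eq. (3)] -/
theorem certP_DL1 : bernCert 0 5 4 (POSP .DL1) [[1024, 4608, 8192, 7136, 3016, 486]] = true := by decide +kernel
/-- `2·PHI_LLs − 1 ≥ 0` on `ν ∈ [0, 1/4]`. [cite: GarloffSmith2001, §2.1 Lemma 1 (i) eq. (3)] -/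
theorem certP_LLs : bernCert 0 5 4 (POSP .LLs) [[1024, 5120, 10368, 10656, 5592, 1212]] = true := by decide +kernel
/-- `2·PHI_LLp0 − 1 ≥ 0` on `ν ∈ [0, 1/4]`. [cite: GarloffSmith2001, §2.1 Lemma 1 (i) eq. (3)] -/
theorem certP_LLp0 : bernCert 0 5 4 (POSP .LLp0) [[1024, 5120, 10240, 10240, 5120, 1024]] = true := by decide +kernel
/-- `2·PHI_LLp1 − 1 ≥ 0` on `ν ∈ [0, 1/4]`. [cite: GarloffSmith2001, §2.1 Lemma 1 (i) eq. (3)] -/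
theorem certP_LLp1 : bernCert 0 5 4 (POSP .LLp1) [[1024, 4608, 8192, 7136, 3016, 486]] = true := by decide +kernel
/-- `2·PHI_LD0 − 1 ≥ 0` on `ν ∈ [0, 1/4]`. [cite: GarloffSmith2001, §2.1 Lemma 1 (i) eq. (3)] -/
theorem certP_LD0 : bernCert 0 5 4 (POSP .LD0) [[1024, 5120, 10240, 10240, 5120, 1024]] = true := by decide +kernel
/-- `2·PHI_LD1 − 1 ≥ 0` on `ν ∈ [0, 1/4]`. [cite: GarloffSmith2001, §2.1 Lemma 1 (i) eq. (3)] -/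
theorem certP_LD1 : bernCert 0 5 4 (POSP .LD1) [[1024, 4608, 8192, 7136, 3016, 486]] = true := by decide +kernel
/-- `2·PHI_DD − 1 ≥ 0` on `ν ∈ [0, 1/4]`. [cite: GarloffSmith2001, §2.1 Lemma 1 (i) eq. (3)] -/
theorem certP_DD : bernCert 0 5 4 (POSP .DD) [[1024, 5120, 10368, 10656, 5592, 1212]] = true := by decide +kernel

/-! ### The supersolutions and the bounds -/

section main
variable {d : ℕ}

/-- ★★ **The memory-three supersolution at `y = 1`, `ρ = 2D − 1 − 1/(2D) + 2/(2D)²`** (`D = d+1`): the thirteen row inequalities hold for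
`φ(s) = PHI_s(1/(2d+2))`. [cite: MadrasSlade1993, §1.2, eq. (1.2.12)–(1.2.14)] [cite: GarloffSmith2001, §2.1 Lemma 1 (i) eq. (3)] -/
theorem supersolution1 (hd : 1 ≤ d) :
    Supersolution d 1 (2 * d + 1 - 1 / (2 * d + 2) + 2 / (2 * d + 2) ^ 2) (phi (1 / (2 * d + 2))) := by
  have hd1 : (1 : ℝ) ≤ d := by exact_mod_cast (le_trans (by norm_num) hd : 1 ≤ d)
  have hD : (0 : ℝ) < 2 * d + 2 := by positivity
  set ν : ℝ := 1 / (2 * d + 2) with hν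
  have hν0 : 0 ≤ ν := by positivity
  have h14 : ((4 : ℕ) : ℝ) * ν ≤ 1 := by rw [hν, mul_one_div, div_le_one hD]; push_cast; linarith
  have h1s : (1 : ℕ) ≤ 4 := by norm_num
  -- dictionary: (2d+2)·ν = 1, (2d+2)(1 − (k+2)ν) = 2d − k, (2d+2)·(νρ) = ρ
  have eN : (2 * d + 2) * evalB NU 0 ν = 1 := by
    simp only [NU, evalB_cons, evalB_nil, evalU_cons, evalU_nil]; rw [hν]; field_simp; ring
  have eL0 : (2 * d + 2) * evalB (LAT 0) 0 ν = 2 * d := by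
    simp only [LAT, evalB_cons, evalB_nil, evalU_cons, evalU_nil]; rw [hν]; push_cast; field_simp; ring
  have eL1 : (2 * d + 2) * evalB (LAT 1) 0 ν = 2 * d - 1 := by
    simp only [LAT, evalB_cons, evalB_nil, evalU_cons, evalU_nil]; rw [hν]; push_cast; field_simp; ring
  have eL2 : (2 * d + 2) * evalB (LAT 2) 0 ν = 2 * d - 2 := by
    simp only [LAT, evalB_cons, evalB_nil, evalU_cons, evalU_nil]; rw [hν]; push_cast; field_simp; ring
  have eL3 : (2 * d + 2) * evalB (LAT 3) 0 ν = 2 * d - 3 := by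
    simp only [LAT, evalB_cons, evalB_nil, evalU_cons, evalU_nil]; rw [hν]; push_cast; field_simp; ring
  have eR1 : (2 * d + 2) * evalB RHO1 0 ν = (2 * d + 1 - 1 / (2 * d + 2) + 2 / (2 * d + 2) ^ 2) := by
    simp only [RHO1, evalB_cons, evalB_nil, evalU_cons, evalU_nil]; rw [hν]; push_cast; field_simp; ring
  -- positivity of φ: 2·PHI_s − 1 ≥ 0
  have hpos : ∀ s, 0 < phi ν s := by
    have P : ∀ {T : List (List ℤ)} {m : ℕ} {C : List (List ℤ)}, bernCert 0 m 4 (subB (smulB 2 T) [[1]]) C = true → 0 < evalB T 0 ν := by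
      intro T m C h
      have := evalB_nonneg_of_bernCert h (by norm_num) le_rfl zero_le_one hν0 h14
      simp only [evalB_subB, evalB_smulB, evalB_const] at this; push_cast at this; linarith
    intro s; cases s
    · exact P certP_UU
    · exact P certP_LU0
    · exact P certP_LU1
    · exact P certP_UL0
    · exact P certP_UL1
    · exact P certP_DL0
    · exact P certP_DL1
    · exact P certP_LLs
    · exact P certP_LLp0
    · exact P certP_LLp1
    · exact P certP_LD0
    · exact P certP_LD1
    · exact P certP_DD
  have cUU := evalB_nonneg_of_bernCert cert1_UU h1s le_rfl zero_le_one hν0 h14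
  have cLU0 := evalB_nonneg_of_bernCert cert1_LU0 h1s le_rfl zero_le_one hν0 h14
  have cLU1 := evalB_nonneg_of_bernCert cert1_LU1 h1s le_rfl zero_le_one hν0 h14
  have cUL0 := evalB_nonneg_of_bernCert cert1_UL0 h1s le_rfl zero_le_one hν0 h14
  have cUL1 := evalB_nonneg_of_bernCert cert1_UL1 h1s le_rfl zero_le_one hν0 h14
  have cDL0 := evalB_nonneg_of_bernCert cert1_DL0 h1s le_rfl zero_le_one hν0 h14
  have cDL1 := evalB_nonneg_of_bernCert cert1_DL1 h1s le_rfl zero_le_one hν0 h14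
  have cLLs := evalB_nonneg_of_bernCert cert1_LLs h1s le_rfl zero_le_one hν0 h14
  have cLLp0 := evalB_nonneg_of_bernCert cert1_LLp0 h1s le_rfl zero_le_one hν0 h14
  have cLLp1 := evalB_nonneg_of_bernCert cert1_LLp1 h1s le_rfl zero_le_one hν0 h14
  have cLD0 := evalB_nonneg_of_bernCert cert1_LD0 h1s le_rfl zero_le_one hν0 h14
  have cLD1 := evalB_nonneg_of_bernCert cert1_LD1 h1s le_rfl zero_le_one hν0 h14
  have cDD := evalB_nonneg_of_bernCert cert1_DD h1s le_rfl zero_le_one hν0 h14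
  simp only [ROW1, TRF, PHI, evalB_subB, evalB_addB, evalB_mulB] at cUU cLU0 cLU1 cUL0 cUL1 cDL0 cDL1 cLLs cLLp0 cLLp1 cLD0 cLD1 cDD
  refine ⟨hpos, ?_, ?_, ?_, ?_, ?_, ?_, ?_, ?_, ?_, ?_, ?_, ?_, ?_⟩
  · refine sub_nonneg.1 ?_
    have := mul_nonneg hD.le cUU
    calc (0 : ℝ) ≤ _ := this
      _ = _ := by simp only [phi, PHI, one_mul]; linear_combination evalB PHI_UU 0 ν * eR1 - evalB PHI_UU 0 ν * eN - evalB PHI_UL0 0 ν * eL0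
  · refine sub_nonneg.1 ?_
    have := mul_nonneg hD.le cLU0
    calc (0 : ℝ) ≤ _ := this
      _ = _ := by simp only [phi, PHI, one_mul]; linear_combination evalB PHI_LU0 0 ν * eR1 - evalB PHI_UU 0 ν * eN - evalB PHI_UL0 0 ν * eL1 - evalB PHI_UL1 0 ν * eN
  · refine sub_nonneg.1 ?_
    have := mul_nonneg hD.le cLU1
    calc (0 : ℝ) ≤ _ := this
      _ = _ := by simp only [phi, PHI, one_mul]; linear_combination evalB PHI_LU1 0 ν * eR1 - evalB PHI_UU 0 ν * eN - evalB PHI_UL0 0 ν * eL1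
  · refine sub_nonneg.1 ?_
    have := mul_nonneg hD.le cUL0
    calc (0 : ℝ) ≤ _ := this
      _ = _ := by simp only [phi, PHI, inv_one, one_mul]; linear_combination evalB PHI_UL0 0 ν * eR1 - evalB PHI_LU0 0 ν * eN - evalB PHI_LD1 0 ν * eN - evalB PHI_LLs 0 ν * eN - evalB PHI_LLp0 0 ν * eL2
  · refine sub_nonneg.1 ?_
    have := mul_nonneg hD.le cUL1
    calc (0 : ℝ) ≤ _ := this
      _ = _ := by simp only [phi, PHI, one_mul]; linear_combination evalB PHI_UL1 0 ν * eR1 - evalB PHI_LU0 0 ν * eN - evalB PHI_LLs 0 ν * eN - evalB PHI_LLp0 0 ν * eL2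
  · refine sub_nonneg.1 ?_
    have := mul_nonneg hD.le cDL0
    calc (0 : ℝ) ≤ _ := this
      _ = _ := by simp only [phi, PHI, inv_one, one_mul]; linear_combination evalB PHI_DL0 0 ν * eR1 - evalB PHI_LU1 0 ν * eN - evalB PHI_LD0 0 ν * eN - evalB PHI_LLs 0 ν * eN - evalB PHI_LLp0 0 ν * eL2
  · refine sub_nonneg.1 ?_
    have := mul_nonneg hD.le cDL1
    calc (0 : ℝ) ≤ _ := this
      _ = _ := by simp only [phi, PHI, inv_one, one_mul]; linear_combination evalB PHI_DL1 0 ν * eR1 - evalB PHI_LD0 0 ν * eN - evalB PHI_LLs 0 ν * eN - evalB PHI_LLp0 0 ν * eL2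
  · refine sub_nonneg.1 ?_
    have := mul_nonneg hD.le cLLs
    calc (0 : ℝ) ≤ _ := this
      _ = _ := by simp only [phi, PHI, inv_one, one_mul]; linear_combination evalB PHI_LLs 0 ν * eR1 - evalB PHI_LU0 0 ν * eN - evalB PHI_LD0 0 ν * eN - evalB PHI_LLs 0 ν * eN - evalB PHI_LLp0 0 ν * eL2
  · intro _hd2
    refine sub_nonneg.1 ?_
    have := mul_nonneg hD.le cLLp0
    calc (0 : ℝ) ≤ _ := this
      _ = _ := by simp only [phi, PHI, inv_one, one_mul]; linear_combination evalB PHI_LLp0 0 ν * eR1 - evalB PHI_LU0 0 ν * eN - evalB PHI_LD0 0 ν * eN - evalB PHI_LLs 0 ν * eN - evalB PHI_LLp0 0 ν * eL3 - evalB PHI_LLp1 0 ν * eN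
  · intro _hd2
    refine sub_nonneg.1 ?_
    have := mul_nonneg hD.le cLLp1
    calc (0 : ℝ) ≤ _ := this
      _ = _ := by simp only [phi, PHI, inv_one, one_mul]; linear_combination evalB PHI_LLp1 0 ν * eR1 - evalB PHI_LU0 0 ν * eN - evalB PHI_LD0 0 ν * eN - evalB PHI_LLs 0 ν * eN - evalB PHI_LLp0 0 ν * eL3
  · refine sub_nonneg.1 ?_
    have := mul_nonneg hD.le cLD0
    calc (0 : ℝ) ≤ _ := this
      _ = _ := by simp only [phi, PHI, inv_one, one_mul]; linear_combination evalB PHI_LD0 0 ν * eR1 - evalB PHI_DD 0 ν * eN - evalB PHI_DL0 0 ν * eL1 - evalB PHI_DL1 0 ν * eN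
  · refine sub_nonneg.1 ?_
    have := mul_nonneg hD.le cLD1
    calc (0 : ℝ) ≤ _ := this
      _ = _ := by simp only [phi, PHI, inv_one, one_mul]; linear_combination evalB PHI_LD1 0 ν * eR1 - evalB PHI_DD 0 ν * eN - evalB PHI_DL0 0 ν * eL1
  · refine sub_nonneg.1 ?_
    have := mul_nonneg hD.le cDD
    calc (0 : ℝ) ≤ _ := this
      _ = _ := by simp only [phi, PHI, inv_one, one_mul]; linear_combination evalB PHI_DD 0 ν * eR1 - evalB PHI_DD 0 ν * eN - evalB PHI_DL0 0 ν * eL0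

/-- ★★ **The memory-three supersolution at `y = 1`, `ρ = 2D − 1 − 1/(2D) + 1/(2D)² + 1/(2D)³`** (`D = d+1`): the thirteen row inequalities hold for
`φ(s) = PHI_s(1/(2d+2))`. [cite: MadrasSlade1993, §1.2, eq. (1.2.12)–(1.2.14)] [cite: GarloffSmith2001, §2.1 Lemma 1 (i) eq. (3)] -/
theorem supersolution2 (hd : 2 ≤ d) :
    Supersolution d 1 (2 * d + 1 - 1 / (2 * d + 2) + 1 / (2 * d + 2) ^ 2 + 1 / (2 * d + 2) ^ 3) (phi (1 / (2 * d + 2))) := by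
  have hd1 : (1 : ℝ) ≤ d := by exact_mod_cast (le_trans (by norm_num) hd : 1 ≤ d)
  have hD : (0 : ℝ) < 2 * d + 2 := by positivity
  set ν : ℝ := 1 / (2 * d + 2) with hν
  have hν0 : 0 ≤ ν := by positivity
  have h14 : ((4 : ℕ) : ℝ) * ν ≤ 1 := by rw [hν, mul_one_div, div_le_one hD]; push_cast; linarith
  have h1s : (1 : ℕ) ≤ 6 := by norm_num
  have hd2 : (2 : ℝ) ≤ d := by exact_mod_cast hd
  have h16 : ((6 : ℕ) : ℝ) * ν ≤ 1 := by rw [hν, mul_one_div, div_le_one hD]; push_cast; linarith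
  -- dictionary: (2d+2)·ν = 1, (2d+2)(1 − (k+2)ν) = 2d − k, (2d+2)·(νρ) = ρ
  have eN : (2 * d + 2) * evalB NU 0 ν = 1 := by
    simp only [NU, evalB_cons, evalB_nil, evalU_cons, evalU_nil]; rw [hν]; field_simp; ring
  have eL0 : (2 * d + 2) * evalB (LAT 0) 0 ν = 2 * d := by
    simp only [LAT, evalB_cons, evalB_nil, evalU_cons, evalU_nil]; rw [hν]; push_cast; field_simp; ring
  have eL1 : (2 * d + 2) * evalB (LAT 1) 0 ν = 2 * d - 1 := by
    simp only [LAT, evalB_cons, evalB_nil, evalU_cons, evalU_nil]; rw [hν]; push_cast; field_simp; ring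
  have eL2 : (2 * d + 2) * evalB (LAT 2) 0 ν = 2 * d - 2 := by
    simp only [LAT, evalB_cons, evalB_nil, evalU_cons, evalU_nil]; rw [hν]; push_cast; field_simp; ring
  have eL3 : (2 * d + 2) * evalB (LAT 3) 0 ν = 2 * d - 3 := by
    simp only [LAT, evalB_cons, evalB_nil, evalU_cons, evalU_nil]; rw [hν]; push_cast; field_simp; ring
  have eR2 : (2 * d + 2) * evalB RHO2 0 ν = (2 * d + 1 - 1 / (2 * d + 2) + 1 / (2 * d + 2) ^ 2 + 1 / (2 * d + 2) ^ 3) := by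
    simp only [RHO2, evalB_cons, evalB_nil, evalU_cons, evalU_nil]; rw [hν]; push_cast; field_simp; ring
  -- positivity of φ: 2·PHI_s − 1 ≥ 0
  have hpos : ∀ s, 0 < phi ν s := by
    have P : ∀ {T : List (List ℤ)} {m : ℕ} {C : List (List ℤ)}, bernCert 0 m 4 (subB (smulB 2 T) [[1]]) C = true → 0 < evalB T 0 ν := by
      intro T m C h
      have := evalB_nonneg_of_bernCert h (by norm_num) le_rfl zero_le_one hν0 h14
      simp only [evalB_subB, evalB_smulB, evalB_const] at this; push_cast at this; linarith
    intro s; cases s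
    · exact P certP_UU
    · exact P certP_LU0
    · exact P certP_LU1
    · exact P certP_UL0
    · exact P certP_UL1
    · exact P certP_DL0
    · exact P certP_DL1
    · exact P certP_LLs
    · exact P certP_LLp0
    · exact P certP_LLp1
    · exact P certP_LD0
    · exact P certP_LD1
    · exact P certP_DD
  have cUU := evalB_nonneg_of_bernCert cert2_UU h1s le_rfl zero_le_one hν0 h16
  have cLU0 := evalB_nonneg_of_bernCert cert2_LU0 h1s le_rfl zero_le_one hν0 h16
  have cLU1 := evalB_nonneg_of_bernCert cert2_LU1 h1s le_rfl zero_le_one hν0 h16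
  have cUL0 := evalB_nonneg_of_bernCert cert2_UL0 h1s le_rfl zero_le_one hν0 h16
  have cUL1 := evalB_nonneg_of_bernCert cert2_UL1 h1s le_rfl zero_le_one hν0 h16
  have cDL0 := evalB_nonneg_of_bernCert cert2_DL0 h1s le_rfl zero_le_one hν0 h16
  have cDL1 := evalB_nonneg_of_bernCert cert2_DL1 h1s le_rfl zero_le_one hν0 h16
  have cLLs := evalB_nonneg_of_bernCert cert2_LLs h1s le_rfl zero_le_one hν0 h16
  have cLLp0 := evalB_nonneg_of_bernCert cert2_LLp0 h1s le_rfl zero_le_one hν0 h16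
  have cLLp1 := evalB_nonneg_of_bernCert cert2_LLp1 h1s le_rfl zero_le_one hν0 h16
  have cLD0 := evalB_nonneg_of_bernCert cert2_LD0 h1s le_rfl zero_le_one hν0 h16
  have cLD1 := evalB_nonneg_of_bernCert cert2_LD1 h1s le_rfl zero_le_one hν0 h16
  have cDD := evalB_nonneg_of_bernCert cert2_DD h1s le_rfl zero_le_one hν0 h16
  simp only [ROW2, TRF, PHI, evalB_subB, evalB_addB, evalB_mulB] at cUU cLU0 cLU1 cUL0 cUL1 cDL0 cDL1 cLLs cLLp0 cLLp1 cLD0 cLD1 cDD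
  refine ⟨hpos, ?_, ?_, ?_, ?_, ?_, ?_, ?_, ?_, ?_, ?_, ?_, ?_, ?_⟩
  · refine sub_nonneg.1 ?_
    have := mul_nonneg hD.le cUU
    calc (0 : ℝ) ≤ _ := this
      _ = _ := by simp only [phi, PHI, one_mul]; linear_combination evalB PHI_UU 0 ν * eR2 - evalB PHI_UU 0 ν * eN - evalB PHI_UL0 0 ν * eL0
  · refine sub_nonneg.1 ?_
    have := mul_nonneg hD.le cLU0
    calc (0 : ℝ) ≤ _ := this
      _ = _ := by simp only [phi, PHI, one_mul]; linear_combination evalB PHI_LU0 0 ν * eR2 - evalB PHI_UU 0 ν * eN - evalB PHI_UL0 0 ν * eL1 - evalB PHI_UL1 0 ν * eN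
  · refine sub_nonneg.1 ?_
    have := mul_nonneg hD.le cLU1
    calc (0 : ℝ) ≤ _ := this
      _ = _ := by simp only [phi, PHI, one_mul]; linear_combination evalB PHI_LU1 0 ν * eR2 - evalB PHI_UU 0 ν * eN - evalB PHI_UL0 0 ν * eL1
  · refine sub_nonneg.1 ?_
    have := mul_nonneg hD.le cUL0
    calc (0 : ℝ) ≤ _ := this
      _ = _ := by simp only [phi, PHI, inv_one, one_mul]; linear_combination evalB PHI_UL0 0 ν * eR2 - evalB PHI_LU0 0 ν * eN - evalB PHI_LD1 0 ν * eN - evalB PHI_LLs 0 ν * eN - evalB PHI_LLp0 0 ν * eL2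
  · refine sub_nonneg.1 ?_
    have := mul_nonneg hD.le cUL1
    calc (0 : ℝ) ≤ _ := this
      _ = _ := by simp only [phi, PHI, one_mul]; linear_combination evalB PHI_UL1 0 ν * eR2 - evalB PHI_LU0 0 ν * eN - evalB PHI_LLs 0 ν * eN - evalB PHI_LLp0 0 ν * eL2
  · refine sub_nonneg.1 ?_
    have := mul_nonneg hD.le cDL0
    calc (0 : ℝ) ≤ _ := this
      _ = _ := by simp only [phi, PHI, inv_one, one_mul]; linear_combination evalB PHI_DL0 0 ν * eR2 - evalB PHI_LU1 0 ν * eN - evalB PHI_LD0 0 ν * eN - evalB PHI_LLs 0 ν * eN - evalB PHI_LLp0 0 ν * eL2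
  · refine sub_nonneg.1 ?_
    have := mul_nonneg hD.le cDL1
    calc (0 : ℝ) ≤ _ := this
      _ = _ := by simp only [phi, PHI, inv_one, one_mul]; linear_combination evalB PHI_DL1 0 ν * eR2 - evalB PHI_LD0 0 ν * eN - evalB PHI_LLs 0 ν * eN - evalB PHI_LLp0 0 ν * eL2
  · refine sub_nonneg.1 ?_
    have := mul_nonneg hD.le cLLs
    calc (0 : ℝ) ≤ _ := this
      _ = _ := by simp only [phi, PHI, inv_one, one_mul]; linear_combination evalB PHI_LLs 0 ν * eR2 - evalB PHI_LU0 0 ν * eN - evalB PHI_LD0 0 ν * eN - evalB PHI_LLs 0 ν * eN - evalB PHI_LLp0 0 ν * eL2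
  · intro _hd2
    refine sub_nonneg.1 ?_
    have := mul_nonneg hD.le cLLp0
    calc (0 : ℝ) ≤ _ := this
      _ = _ := by simp only [phi, PHI, inv_one, one_mul]; linear_combination evalB PHI_LLp0 0 ν * eR2 - evalB PHI_LU0 0 ν * eN - evalB PHI_LD0 0 ν * eN - evalB PHI_LLs 0 ν * eN - evalB PHI_LLp0 0 ν * eL3 - evalB PHI_LLp1 0 ν * eN
  · intro _hd2
    refine sub_nonneg.1 ?_
    have := mul_nonneg hD.le cLLp1
    calc (0 : ℝ) ≤ _ := this
      _ = _ := by simp only [phi, PHI, inv_one, one_mul]; linear_combination evalB PHI_LLp1 0 ν * eR2 - evalB PHI_LU0 0 ν * eN - evalB PHI_LD0 0 ν * eN - evalB PHI_LLs 0 ν * eN - evalB PHI_LLp0 0 ν * eL3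
  · refine sub_nonneg.1 ?_
    have := mul_nonneg hD.le cLD0
    calc (0 : ℝ) ≤ _ := this
      _ = _ := by simp only [phi, PHI, inv_one, one_mul]; linear_combination evalB PHI_LD0 0 ν * eR2 - evalB PHI_DD 0 ν * eN - evalB PHI_DL0 0 ν * eL1 - evalB PHI_DL1 0 ν * eN
  · refine sub_nonneg.1 ?_
    have := mul_nonneg hD.le cLD1
    calc (0 : ℝ) ≤ _ := this
      _ = _ := by simp only [phi, PHI, inv_one, one_mul]; linear_combination evalB PHI_LD1 0 ν * eR2 - evalB PHI_DD 0 ν * eN - evalB PHI_DL0 0 ν * eL1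
  · refine sub_nonneg.1 ?_
    have := mul_nonneg hD.le cDD
    calc (0 : ℝ) ≤ _ := this
      _ = _ := by simp only [phi, PHI, inv_one, one_mul]; linear_combination evalB PHI_DD 0 ν * eR2 - evalB PHI_DD 0 ν * eN - evalB PHI_DL0 0 ν * eL0

end main

end MuUpper

/-- ★ **`μ(ℤ^{d+1}) ≤ 2d + 1 − 1/(2d+2) + 2/(2d+2)²` for every `d ≥ 1`** — i.e. `μ(ℤ^D) ≤ 2D − 1 − 1/(2D) + 1/(2D²)` in EVERY dimension
`D ≥ 2`, by the memory-three transfer bound at `y = 1` (`e^{λ_B(1)} = μ`).  This is the `≤` form of the tree's `connectiveConstant_lt_kesten_upper`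
(`SAWLoopErasureKesten.lean`, Fisher–Sykes cubic = the characteristic polynomial of this chain), by an independent certificate proof. [cite: MadrasSlade1993, §1.2, eq. (1.2.12)–(1.2.14)] [cite: HaraSladeSokal1993, §6.2 eq. (6.17)] -/
theorem connectiveConstant_le_memoryThree (d : ℕ) (hd : 1 ≤ d) :
    connectiveConstant (d + 1) ≤ (2 * d + 1 - 1 / (2 * d + 2) + 2 / (2 * d + 2) ^ 2) := by
  have hS := MuUpper.supersolution1 (d := d) hd
  have hD : (0 : ℝ) < 2 * d + 2 := by positivity
  have hρ : (0 : ℝ) < (2 * d + 1 - 1 / (2 * d + 2) + 2 / (2 * d + 2) ^ 2) := by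
    have hd1 : (1 : ℝ) ≤ d := by exact_mod_cast hd
    have h1 : 1 / (2 * (d : ℝ) + 2) ≤ 1 := by rw [div_le_one hD]; linarith
    have h2 : (0 : ℝ) ≤ 2 / (2 * d + 2) ^ 2 := by positivity
    linarith
  have h := MemThree.exp_pulledBridgeFreeEnergy_le hS one_pos hρ
  rwa [pulledBridgeFreeEnergy_one d, Real.exp_log (connectiveConstant_pos (d + 1))] at h

/-- ★★ **`μ(ℤ^{d+1}) ≤ 2d + 1 − 1/(2d+2) + 1/(2d+2)² + 1/(2d+2)³` for every `d ≥ 2`** — i.e. `μ(ℤ^D) ≤ 2D − 1 − 1/(2D) + 1/(2D)² + 1/(2D)³`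
in every dimension `D ≥ 3` (the memory-three Perron root is `2D − 1 − 1/(2D) + 1/(2D)² + 4/(2D)⁴ + …`); sharper than the tree's closed form
`connectiveConstant_lt_fisherSykes_closed_form` (`2d − 1 − 1/(2d+2)` in the dimension `d`) for every `D ≥ 3`, same Fisher–Sykes ceiling. [cite: MadrasSlade1993, §1.2, eq. (1.2.12)–(1.2.14)] [cite: HaraSladeSokal1993, §6.2 eq. (6.17)] -/
theorem connectiveConstant_le_memoryThree' (d : ℕ) (hd : 2 ≤ d) :
    connectiveConstant (d + 1) ≤ (2 * d + 1 - 1 / (2 * d + 2) + 1 / (2 * d + 2) ^ 2 + 1 / (2 * d + 2) ^ 3) := by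
  have hS := MuUpper.supersolution2 (d := d) hd
  have hD : (0 : ℝ) < 2 * d + 2 := by positivity
  have hρ : (0 : ℝ) < (2 * d + 1 - 1 / (2 * d + 2) + 1 / (2 * d + 2) ^ 2 + 1 / (2 * d + 2) ^ 3) := by
    have hd1 : (2 : ℝ) ≤ d := by exact_mod_cast hd
    have h1 : 1 / (2 * (d : ℝ) + 2) ≤ 1 := by rw [div_le_one hD]; linarith
    have h2 : (0 : ℝ) ≤ 1 / (2 * d + 2) ^ 2 := by positivity
    have h3 : (0 : ℝ) ≤ 1 / (2 * d + 2) ^ 3 := by positivity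
    linarith
  have h := MemThree.exp_pulledBridgeFreeEnergy_le hS one_pos hρ
  rwa [pulledBridgeFreeEnergy_one d, Real.exp_log (connectiveConstant_pos (d + 1))] at h

/-- The same in the dimension variable: **`μ(ℤ^D) ≤ 2D − 1 − 1/(2D) + 1/(2D²)` for every `D ≥ 2`** (the `≤` form of the tree's
`connectiveConstant_lt_kesten_upper`, independent proof). [cite: HaraSladeSokal1993, §6.2 eq. (6.17)] -/
theorem connectiveConstant_le_memoryThree_dim (D : ℕ) (hD : 2 ≤ D) :
    connectiveConstant D ≤ 2 * D - 1 - 1 / (2 * D) + 1 / (2 * (D : ℝ) ^ 2) := by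
  obtain ⟨d, rfl⟩ : ∃ d, D = d + 1 := ⟨D - 1, by omega⟩
  have hd : 1 ≤ d := by omega
  have h := connectiveConstant_le_memoryThree d hd
  have hD0 : (0 : ℝ) < 2 * d + 2 := by positivity
  have e : (2 * d + 1 - 1 / (2 * d + 2) + 2 / (2 * d + 2) ^ 2 : ℝ) = 2 * ((d + 1 : ℕ) : ℝ) - 1 - 1 / (2 * ((d + 1 : ℕ) : ℝ)) + 1 / (2 * ((d + 1 : ℕ) : ℝ) ^ 2) := by
    push_cast; field_simp; ring
  rw [e] at h; exact h

/-- The sharper bound in the dimension variable: **`μ(ℤ^D) ≤ 2D − 1 − 1/(2D) + 1/(2D)² + 1/(2D)³` for every `D ≥ 3`** — below the tree's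
closed form `2D − 1 − 1/(2D+2)` (`connectiveConstant_lt_fisherSykes_closed_form`) by `1/(2D) − 1/(2D+2) − 1/(2D)² − 1/(2D)³ > 0`.
[cite: MadrasSlade1993, §1.2, eq. (1.2.12)–(1.2.14)] -/
theorem connectiveConstant_le_memoryThree_dim' (D : ℕ) (hD : 3 ≤ D) :
    connectiveConstant D ≤ 2 * D - 1 - 1 / (2 * D) + 1 / (2 * (D : ℝ)) ^ 2 + 1 / (2 * (D : ℝ)) ^ 3 := by
  obtain ⟨d, rfl⟩ : ∃ d, D = d + 1 := ⟨D - 1, by omega⟩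
  have hd : 2 ≤ d := by omega
  have h := connectiveConstant_le_memoryThree' d hd
  have hD0 : (0 : ℝ) < 2 * d + 2 := by positivity
  have e : (2 * d + 1 - 1 / (2 * d + 2) + 1 / (2 * d + 2) ^ 2 + 1 / (2 * d + 2) ^ 3 : ℝ)
      = 2 * ((d + 1 : ℕ) : ℝ) - 1 - 1 / (2 * ((d + 1 : ℕ) : ℝ)) + 1 / (2 * ((d + 1 : ℕ) : ℝ)) ^ 2 + 1 / (2 * ((d + 1 : ℕ) : ℝ)) ^ 3 := by
    push_cast; ring
  rw [e] at h; exact h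

/-- **Comparison with the tree's closed form**: for `D ≥ 3` the bound of `connectiveConstant_le_memoryThree_dim'` is strictly below
`2D − 1 − 1/(2D+2)`. [cite: MadrasSlade1993, §1.2, eq. (1.2.12)–(1.2.14)] -/
theorem memoryThree_bound_lt_fisherSykes_closed_form (D : ℕ) (hD : 3 ≤ D) :
    2 * D - 1 - 1 / (2 * D) + 1 / (2 * (D : ℝ)) ^ 2 + 1 / (2 * (D : ℝ)) ^ 3 < 2 * D - 1 - 1 / (2 * (D : ℝ) + 2) := by
  have hD3 : (3 : ℝ) ≤ D := by exact_mod_cast hD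
  have hD0 : (0 : ℝ) < D := by linarith
  rw [← sub_pos]
  have e : (2 * D - 1 - 1 / (2 * (D : ℝ) + 2)) - (2 * D - 1 - 1 / (2 * D) + 1 / (2 * (D : ℝ)) ^ 2 + 1 / (2 * (D : ℝ)) ^ 3)
      = (2 * (D : ℝ) ^ 2 - 3 * D - 1) / (8 * (D : ℝ) ^ 3 * (D + 1)) := by
    field_simp; ring
  rw [e]; apply div_pos _ (by positivity); nlinarith

end Literature.Probability.RandomPlanarGeometry.SAW.Zd
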